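import Summits.AtomisticToContinuum.HydrodynamicLimit.Theorems.MourreKoopmanChargesOneBodyCompletenessTorusStatics
import Summits.AtomisticToContinuum.HydrodynamicLimit.Theorems.AntiMazurCoboundariesKineticWindowGronwallBoostRegular
import Summits.AtomisticToContinuum.HydrodynamicLimit.Theorems.AntiMazurCoboundariesKineticWindowGronwallBoostGibbs
import Summits.AtomisticToContinuum.HydrodynamicLimit.Theorems.OneFlightGossipEngineEquilibriumStressVarianceDecayGreenKubo
import Summits.AtomisticToContinuum.HydrodynamicLimit.Theorems.AntiMazurCoboundariesExponentialCertificate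
import HarnessLib

/-!
# Preparations for the Galilean rung of the crux `LinearToEntropyInBand` (stmt-AtomisticToContinuum-17740),
# route `MourreKoopmanCharges`: Galilean covariance of the `OneBodyCompleteness` correlation

Support file 1/2 (`--supports stmt-AtomisticToContinuum-17740`; registered bookkeeping stub
`stub_maxwellianOrthGalilean`) of the line `registered`, skeleton v5 (`Cruxes/LinearToEntropyInBand/Lines/birth.lean`);
the rung itself (`stub_oneBodyCompletenessGalilean`: `OneBodyCompleteness` at drift `0` ⟹ the same Cesàro decay under
the homogeneous canonical law with every drift `u`) is `Theorems/MourreKoopmanChargesLinearToEntropyInBandGalileanRung.lean`.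

The route's typed Mourre output `MourreKoopmanCharges.OneBodyCompleteness` (stmt-9583) is the Cesàro decay of the
rescaled two-time correlation `(N+1) · E_{G_0}[A_h(χ)(Φ_t z) A_h(χ)(z)]` of the one-body empirical field
`A_h(χ)(z) = (N+1)⁻¹ Σᵢ χ(xᵢ) h(vᵢ)` under the canonical law `G_0 = localGibbsLaw σ 1 0 θ` AT DRIFT `0`, for
`h ⊥ {1, v, |v|²}` in `L²(M_θ)`.  This file supplies the Galilean dictionary to the drifted law
`G_u = localGibbsLaw σ 1 u θ`, everything landed:

* § 0 tools: Cauchy–Schwarz `|∫ f g| ≤ ‖f‖₂ ‖g‖₂`; the perturbed two-time correlation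
  `|∫ A₁(T w) A(w) − ∫ A(T w) A(w)| ≤ ‖A₁ − A‖₂ ‖A‖₂` under an invariant map; interval integrability of rescaled
  correlation kernels (`AntiMazurCoboundariesExponentialCertificate.intervalIntegrable_of_bounded`); Cesàro means of nearby kernels; uniform continuity of `χ` along translations of `𝕋³`;
* § 1 `stub_maxwellianOrthGalilean` / `orth_translate`: `M_{θ,u}`-orthogonality of `h` to `1, vᵢ, |v|²` is
  `M_{θ,0}`-orthogonality of `g = h(· + u)` (translation of the Gaussian velocity law `gaussMeasure_map_add_const`,
  expansion of `(v + u)ᵢ` and `‖v + u‖²`, Gaussian integrability of polynomially bounded profiles);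
* § 2 kinematics: `A_h(χ)(boostAt u t y) = A_g(χ_t)(y)`, `χ_t = χ(· + proj(t u))` (`oneBodyField_boostAt`), linearity
  in the test function;
* § 3 statics under `G_0`: `(N+1) E[A_g(ψ)²] = (∫ψ²) ∫g²M_θ` (`torusStaticVariance`), whence the cost of a perturbed
  test function `(N+1)|E[A_g(χ₁)(Ψ_t w)A_g(χ)(w)] − E[A_g(χ)(Ψ_t w)A_g(χ)(w)]| ≤ (∫(χ₁−χ)² ∫g²M_θ)^{1/2}(∫χ² ∫g²M_θ)^{1/2}`
  (Cauchy–Schwarz + stationarity `measurePreserving_flow_localGibbsLaw`);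
The boost identity `E_{G_u}[A_h(χ)(Φ_t z) A_h(χ)(z)] = E_{G_0}[A_g(χ_t)(Ψ_t w) A_g(χ)(w)]` itself and the Cesàro
assembly are in file 2/2.

References: H. Spohn, *Large Scale Dynamics of Interacting Particles* (1991), Part I §2.3 (Galilean invariance of
the local equilibrium states) and §7.1; folklore otherwise.
-/

noncomputable section

namespace Summit.AtomisticToContinuum.HydrodynamicLimit.Theorems.LTEInBand

open MeasureTheory ProbabilityTheory Filter Topology Set
open Literature.Analysis.FluidPDE Literature.MathematicalPhysics.KineticTheory
open Literature.Analysis.FunctionSpaces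
open scoped InnerProductSpace ENNReal BigOperators Interval
open Summit.AtomisticToContinuum.HydrodynamicLimit.Theorems
open MourreKoopmanChargesIdealGasNoDecay MourreKoopmanChargesOneBodyCompleteness KineticWindowGronwallBoost
  EquilibriumStressVarianceDecayC3 BoltzmannGreenKuboOrthMomentum
open Summit.AtomisticToContinuum.HydrodynamicLimit.Theses

/-! ### § 0 Tools -/

section Tools

/-- **Cauchy–Schwarz** for real square-integrable functions: `|∫ f g| ≤ (∫ f²)^{1/2} (∫ g²)^{1/2}`.
[folklore] -/
theorem abs_integral_mul_le_sqrt_mul_sqrt {Ω : Type*} [MeasurableSpace Ω] {μ : Measure Ω} {f g : Ω → ℝ}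
    (hf : MemLp f 2 μ) (hg : MemLp g 2 μ) :
    |∫ ω, f ω * g ω ∂μ| ≤ Real.sqrt (∫ ω, f ω ^ 2 ∂μ) * Real.sqrt (∫ ω, g ω ^ 2 ∂μ) := by
  -- adapted from Literature.MathematicalPhysics.KineticTheory.HeatConduction.abs_integral_mul_le_sqrt_integral_sq_mul
  have h := integral_mul_norm_le_Lp_mul_Lq (μ := μ) (f := fun x => ‖f x‖) (g := fun x => ‖g x‖)
    Real.HolderConjugate.two_two (by simpa using hf.norm) (by simpa using hg.norm)
  simp only [Real.rpow_two, one_div, Real.norm_eq_abs, sq_abs, abs_abs] at h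
  rw [Real.sqrt_eq_rpow, Real.sqrt_eq_rpow, one_div]
  refine le_trans ?_ h
  refine abs_integral_le_integral_abs.trans (le_of_eq ?_)
  exact integral_congr_ae (Eventually.of_forall fun x => abs_mul _ _)

/-- **Two-time correlations with a perturbed first factor**: if `T` preserves `μ`, `A₁, A, D ∈ L²(μ)` and
`A₁ − A = D`, then `|∫ A₁(T w) A(w) dμ − ∫ A(T w) A(w) dμ| ≤ (∫ D²)^{1/2} (∫ A²)^{1/2}` (Cauchy–Schwarz and
`∫ (D ∘ T)² dμ = ∫ D² dμ`). [folklore] -/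
theorem abs_integral_comp_mul_sub_le {α : Type*} [MeasurableSpace α] {μ : Measure α} {T : α → α}
    (hT : MeasurePreserving T μ μ) {A₁ A D : α → ℝ} (hA₁ : MemLp A₁ 2 μ) (hA : MemLp A 2 μ)
    (hDm : Measurable D) (hD : MemLp D 2 μ) (hsub : ∀ w, A₁ w - A w = D w) :
    |(∫ w, A₁ (T w) * A w ∂μ) - ∫ w, A (T w) * A w ∂μ| ≤
      Real.sqrt (∫ w, D w ^ 2 ∂μ) * Real.sqrt (∫ w, A w ^ 2 ∂μ) := by
  have hA₁t : MemLp (fun w => A₁ (T w)) 2 μ := hA₁.comp_measurePreserving hT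
  have hAt : MemLp (fun w => A (T w)) 2 μ := hA.comp_measurePreserving hT
  have hDt : MemLp (fun w => D (T w)) 2 μ := hD.comp_measurePreserving hT
  have hsq : ∫ w, D (T w) ^ 2 ∂μ = ∫ w, D w ^ 2 ∂μ := by
    have h := integral_map_of_stronglyMeasurable (μ := μ) hT.measurable
      ((hDm.pow_const 2).stronglyMeasurable : StronglyMeasurable fun w => D w ^ 2)
    rw [hT.map_eq] at h
    exact h.symm
  have hI₁ : Integrable (fun w => A₁ (T w) * A w) μ := hA₁t.integrable_mul hA
  have hI : Integrable (fun w => A (T w) * A w) μ := hAt.integrable_mul hA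
  have e : (∫ w, A₁ (T w) * A w ∂μ) - ∫ w, A (T w) * A w ∂μ = ∫ w, D (T w) * A w ∂μ := by
    rw [← integral_sub hI₁ hI]
    refine integral_congr_ae (Eventually.of_forall fun w => ?_)
    show A₁ (T w) * A w - A (T w) * A w = D (T w) * A w
    rw [← sub_mul, hsub]
  rw [e, ← hsq]
  exact abs_integral_mul_le_sqrt_mul_sqrt hDt hA

/-- **Uniform continuity along translations** of a continuous function on the compact torus: for
`ε > 0` there is `τ > 0` with `|χ(x + proj p) − χ(x)| ≤ ε` for all `x` once `‖p‖ < τ`. [folklore] -/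
theorem exists_translate_bound {χ : T3 → ℝ} (hχ : Continuous χ) {ε : ℝ} (hε : 0 < ε) :
    ∃ τ : ℝ, 0 < τ ∧ ∀ p : V3, ‖p‖ < τ → ∀ x : T3, |χ (x + Torus.proj p) - χ x| ≤ ε := by
  obtain ⟨ρ, hρ, H⟩ := Metric.uniformContinuous_iff.1 (CompactSpace.uniformContinuous_of_continuous hχ) ε hε
  refine ⟨ρ, hρ, fun p hp x => ?_⟩
  have hd : dist (x + Torus.proj p) x < ρ := by
    rw [dist_eq_norm, add_sub_cancel_left]
    exact (Torus.norm_proj_le p).trans_lt hp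
  have h := H hd
  rw [Real.dist_eq] at h
  exact h.le

/-- A rescaled two-time correlation kernel `s ↦ a · ∫ A(φ_{s c} w) A(w) dμ` is interval integrable once the
correlation `t ↦ ∫ A(w) A(φ_t w) dμ` is measurable and bounded. [folklore] -/
theorem intervalIntegrable_scaled_corr {α : Type*} [MeasurableSpace α] {μ : Measure α} {φ : ℝ → α → α}
    {A : α → ℝ} {B : ℝ} (hm : Measurable fun t => ∫ w, A w * A (φ t w) ∂μ)
    (hb : ∀ t, |∫ w, A w * A (φ t w) ∂μ| ≤ B) (a c S₁ S₂ : ℝ) :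
    IntervalIntegrable (fun s => a * ∫ w, A (φ (s * c) w) * A w ∂μ) volume S₁ S₂ := by
  have e : ∀ t, ∫ w, A (φ t w) * A w ∂μ = ∫ w, A w * A (φ t w) ∂μ := fun t =>
    integral_congr_ae (Eventually.of_forall fun w => mul_comm _ _)
  simp_rw [e]
  refine AntiMazurCoboundariesExponentialCertificate.intervalIntegrable_of_bounded
    ((hm.comp (measurable_id.mul_const c)).const_mul a) (C := |a| * B) (fun s => ?_) S₁ S₂
  rw [abs_mul]
  exact mul_le_mul_of_nonneg_left (hb _) (abs_nonneg a)

/-- **Cesàro means of nearby kernels**: if `|S⁻¹ ∫₀^S F₀| ≤ δ/2`, `F₀` is interval integrable and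
`|F − F₀| ≤ δ/2` on `(0, S]`, then `|S⁻¹ ∫₀^S F| ≤ δ` (if `F` is not interval integrable its integral is `0`).
[folklore] -/
theorem cesaro_abs_le_of_near {F F₀ : ℝ → ℝ} {S δ : ℝ} (hS : 0 < S) (hδ : 0 < δ)
    (hF₀ : IntervalIntegrable F₀ volume 0 S) (h0 : |S⁻¹ * ∫ s in (0 : ℝ)..S, F₀ s| ≤ δ / 2)
    (hdiff : ∀ s ∈ Ι (0 : ℝ) S, |F s - F₀ s| ≤ δ / 2) : |S⁻¹ * ∫ s in (0 : ℝ)..S, F s| ≤ δ := by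
  by_cases hint : IntervalIntegrable F volume 0 S
  · have e : ∫ s in (0 : ℝ)..S, F s = (∫ s in (0 : ℝ)..S, F₀ s) + ∫ s in (0 : ℝ)..S, (F s - F₀ s) := by
      rw [intervalIntegral.integral_sub hint hF₀]
      ring
    have hbd : |∫ s in (0 : ℝ)..S, (F s - F₀ s)| ≤ δ / 2 * S := by
      have hn := intervalIntegral.norm_integral_le_of_norm_le_const (a := (0 : ℝ)) (b := S) (C := δ / 2)
        (f := fun s => F s - F₀ s) (fun s hs => by rw [Real.norm_eq_abs]; exact hdiff s hs)
      rw [Real.norm_eq_abs, sub_zero, abs_of_pos hS] at hn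
      exact hn
    have hSi : 0 < S⁻¹ := inv_pos.2 hS
    calc |S⁻¹ * ∫ s in (0 : ℝ)..S, F s|
        = S⁻¹ * |(∫ s in (0 : ℝ)..S, F₀ s) + ∫ s in (0 : ℝ)..S, (F s - F₀ s)| := by
          rw [e, abs_mul, abs_of_pos hSi]
      _ ≤ S⁻¹ * (|∫ s in (0 : ℝ)..S, F₀ s| + |∫ s in (0 : ℝ)..S, (F s - F₀ s)|) :=
          mul_le_mul_of_nonneg_left (abs_add_le _ _) hSi.le
      _ = |S⁻¹ * ∫ s in (0 : ℝ)..S, F₀ s| + S⁻¹ * |∫ s in (0 : ℝ)..S, (F s - F₀ s)| := by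
          rw [mul_add, abs_mul, abs_of_pos hSi]
      _ ≤ δ / 2 + S⁻¹ * (δ / 2 * S) := add_le_add h0 (mul_le_mul_of_nonneg_left hbd hSi.le)
      _ = δ := by
          field_simp
          ring
  · rw [intervalIntegral.integral_undef hint, mul_zero, abs_zero]
    exact hδ.le

end Tools

/-! ### § 1 Maxwellian orthogonality is Galilean covariant -/

section Maxwellian

/-- Integrals against the drifted Maxwellian are integrals of the velocity-translated function against
the centred Gaussian law: `∫ f M_{θ,u} dv = ∫ f(v + u) dN(0, θ id)(v)`. [folklore] -/
theorem integral_mul_localMaxwellian_eq_gauss {θ : ℝ} (hθ : 0 < θ) (u : V3) (f : V3 → ℝ) :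
    ∫ v, f v * localMaxwellian 1 θ u v = ∫ v, f (v + u) ∂(gaussMeasure (0 : V3) θ) := by
  calc ∫ v, f v * localMaxwellian 1 θ u v = ∫ v, localMaxwellian 1 θ u v • f v := by
        congr 1
        funext v
        rw [smul_eq_mul, mul_comm]
    _ = ∫ w, f (u + Real.sqrt θ • w) ∂stdGaussian V3 := integral_localMaxwellian_smul hθ u f
    _ = ∫ v, f v ∂(gaussMeasure u θ) := (integral_gaussMeasure u hθ f).symm
    _ = ∫ v, f v ∂((gaussMeasure (0 : V3) θ).map (fun v => v + u)) := by
        rw [gaussMeasure_map_add_const, zero_add]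
    _ = ∫ v, f (v + u) ∂(gaussMeasure (0 : V3) θ) := (measurableEmbedding_addRight u).integral_map f

/-- Polynomial growth is stable under velocity translation:
`|h(v + u)| ≤ |C| (1 + ‖u‖)^k (1 + ‖v‖)^k`. [folklore] -/
theorem poly_growth_translate {h : V3 → ℝ} {C : ℝ} {k : ℕ} (hCk : ∀ v, |h v| ≤ C * (1 + ‖v‖) ^ k)
    (u v : V3) : |h (v + u)| ≤ |C| * (1 + ‖u‖) ^ k * (1 + ‖v‖) ^ k := by
  have h1 : 1 + ‖v + u‖ ≤ (1 + ‖u‖) * (1 + ‖v‖) := by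
    nlinarith [norm_add_le v u, norm_nonneg u, norm_nonneg v, mul_nonneg (norm_nonneg u) (norm_nonneg v)]
  calc |h (v + u)| ≤ C * (1 + ‖v + u‖) ^ k := hCk _
    _ ≤ |C| * (1 + ‖v + u‖) ^ k := mul_le_mul_of_nonneg_right (le_abs_self C) (by positivity)
    _ ≤ |C| * ((1 + ‖u‖) * (1 + ‖v‖)) ^ k :=
        mul_le_mul_of_nonneg_left (pow_le_pow_left₀ (by positivity) h1 k) (abs_nonneg C)
    _ = |C| * (1 + ‖u‖) ^ k * (1 + ‖v‖) ^ k := by rw [mul_pow, mul_assoc]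

/-- Multiplying by a coordinate raises the growth exponent by one. [folklore] -/
theorem poly_growth_mul_coord {f : V3 → ℝ} {C : ℝ} {k : ℕ} (hCk : ∀ v, |f v| ≤ C * (1 + ‖v‖) ^ k)
    (i : Fin 3) (v : V3) : |f v * v i| ≤ C * (1 + ‖v‖) ^ (k + 1) := by
  have hC : 0 ≤ C * (1 + ‖v‖) ^ k := (abs_nonneg _).trans (hCk v)
  have hv : |v i| ≤ 1 + ‖v‖ := by
    have h := PiLp.norm_apply_le v i
    rw [Real.norm_eq_abs] at h
    linarith [norm_nonneg v]
  rw [abs_mul, pow_succ, ← mul_assoc]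
  exact mul_le_mul (hCk v) hv (abs_nonneg _) hC

/-- Multiplying by `‖v‖²` raises the growth exponent by two. [folklore] -/
theorem poly_growth_mul_norm_sq {f : V3 → ℝ} {C : ℝ} {k : ℕ} (hCk : ∀ v, |f v| ≤ C * (1 + ‖v‖) ^ k)
    (v : V3) : |f v * ‖v‖ ^ 2| ≤ C * (1 + ‖v‖) ^ (k + 2) := by
  have hC : 0 ≤ C * (1 + ‖v‖) ^ k := (abs_nonneg _).trans (hCk v)
  have hv : |‖v‖ ^ 2| ≤ (1 + ‖v‖) ^ 2 := by
    rw [abs_of_nonneg (sq_nonneg _)]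
    nlinarith [norm_nonneg v]
  rw [abs_mul, pow_add, ← mul_assoc]
  exact mul_le_mul (hCk v) hv (abs_nonneg _) hC

/-- **Maxwellian orthogonality is Galilean covariant.** If `h` (continuous, of polynomial growth) is
`M_{θ,u}`-orthogonal to `1, vᵢ, ‖v‖²`, then `g = h(· + u)` is `M_{θ,0}`-orthogonal to `1, vᵢ, ‖v‖²`
(translate the Gaussian velocity law and expand `(v + u)ᵢ`, `‖v + u‖²`). [folklore] -/
theorem orth_translate {θ : ℝ} (hθ : 0 < θ) (u : V3) {h : V3 → ℝ} (hh : Continuous h) {C : ℝ} {k : ℕ}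
    (hCk : ∀ v, |h v| ≤ C * (1 + ‖v‖) ^ k)
    (h1 : ∫ v, h v * localMaxwellian 1 θ u v = 0)
    (h2 : ∀ i : Fin 3, ∫ v, h v * v i * localMaxwellian 1 θ u v = 0)
    (h3 : ∫ v, h v * ‖v‖ ^ 2 * localMaxwellian 1 θ u v = 0) :
    (∫ v, h (v + u) * localMaxwellian 1 θ (0 : V3) v = 0) ∧
    (∀ i : Fin 3, ∫ v, h (v + u) * v i * localMaxwellian 1 θ (0 : V3) v = 0) ∧
    (∫ v, h (v + u) * ‖v‖ ^ 2 * localMaxwellian 1 θ (0 : V3) v = 0) := by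
  set γ : Measure V3 := gaussMeasure (0 : V3) θ with hγ
  -- the hypotheses under `γ`
  have H1 : ∫ v, h (v + u) ∂γ = 0 := by
    rw [← integral_mul_localMaxwellian_eq_gauss hθ u h]; exact h1
  have H2 : ∀ i : Fin 3, ∫ v, h (v + u) * (v + u) i ∂γ = 0 := fun i => by
    rw [← integral_mul_localMaxwellian_eq_gauss hθ u (fun v => h v * v i)]; exact h2 i
  have H3 : ∫ v, h (v + u) * ‖v + u‖ ^ 2 ∂γ = 0 := by
    rw [← integral_mul_localMaxwellian_eq_gauss hθ u (fun v => h v * ‖v‖ ^ 2)]; exact h3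
  -- integrability under `γ`
  have hgc : Continuous fun v => h (v + u) := hh.comp (continuous_id.add continuous_const)
  have hgCk : ∀ v, |h (v + u)| ≤ |C| * (1 + ‖u‖) ^ k * (1 + ‖v‖) ^ k := poly_growth_translate hCk u
  have hIg : Integrable (fun v => h (v + u)) γ := integrable_of_poly_growth γ hgc.aestronglyMeasurable hgCk
  have hIgi : ∀ i : Fin 3, Integrable (fun v => h (v + u) * v i) γ := fun i =>
    integrable_of_poly_growth γ (hgc.mul (by fun_prop)).aestronglyMeasurable (poly_growth_mul_coord hgCk i)
  have hIg2 : Integrable (fun v => h (v + u) * ‖v‖ ^ 2) γ :=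
    integrable_of_poly_growth γ (hgc.mul (continuous_norm.pow 2)).aestronglyMeasurable
      (poly_growth_mul_norm_sq hgCk)
  -- (i)
  have G1 : ∫ v, h (v + u) * localMaxwellian 1 θ (0 : V3) v = 0 := by
    rw [← integral_gaussMeasure_eq_integral_mul hθ]; exact H1
  -- (ii)
  have G2 : ∀ i : Fin 3, ∫ v, h (v + u) * v i ∂γ = 0 := by
    intro i
    have key : ∫ v, h (v + u) * (v + u) i ∂γ = (∫ v, h (v + u) * v i ∂γ) + u i * ∫ v, h (v + u) ∂γ := by
      rw [← integral_const_mul, ← integral_add (hIgi i) (hIg.const_mul _)]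
      refine integral_congr_ae (Eventually.of_forall fun v => ?_)
      show h (v + u) * (v + u) i = h (v + u) * v i + u i * h (v + u)
      rw [show (v + u) i = v i + u i from rfl]
      ring
    rw [H2 i, H1, mul_zero, add_zero] at key
    exact key.symm
  -- (iii)
  have e3 : ∀ v : V3, ‖v + u‖ ^ 2 = ‖v‖ ^ 2 + 2 * (u 0 * v 0 + u 1 * v 1 + u 2 * v 2) + ‖u‖ ^ 2 := by
    intro v
    rw [EuclideanSpace.real_norm_sq_eq, EuclideanSpace.real_norm_sq_eq, EuclideanSpace.real_norm_sq_eq]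
    simp only [Fin.sum_univ_three, WithLp.ofLp_add, Pi.add_apply]
    ring
  have eR : (fun v => h (v + u) * ‖v + u‖ ^ 2) = fun v => h (v + u) * ‖v‖ ^ 2 +
      (2 * u 0 * (h (v + u) * v 0) + 2 * u 1 * (h (v + u) * v 1) + 2 * u 2 * (h (v + u) * v 2) +
        ‖u‖ ^ 2 * h (v + u)) := by
    funext v
    rw [e3 v]
    ring
  have i0 : Integrable (fun v => 2 * u 0 * (h (v + u) * v 0)) γ := (hIgi 0).const_mul _
  have i1 : Integrable (fun v => 2 * u 1 * (h (v + u) * v 1)) γ := (hIgi 1).const_mul _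
  have i2 : Integrable (fun v => 2 * u 2 * (h (v + u) * v 2)) γ := (hIgi 2).const_mul _
  have i3 : Integrable (fun v => ‖u‖ ^ 2 * h (v + u)) γ := hIg.const_mul _
  have i01 : Integrable (fun v => 2 * u 0 * (h (v + u) * v 0) + 2 * u 1 * (h (v + u) * v 1)) γ := i0.add i1
  have IR' : Integrable (fun v => 2 * u 0 * (h (v + u) * v 0) + 2 * u 1 * (h (v + u) * v 1) +
      2 * u 2 * (h (v + u) * v 2)) γ := i01.add i2
  have IR : Integrable (fun v => 2 * u 0 * (h (v + u) * v 0) + 2 * u 1 * (h (v + u) * v 1) +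
      2 * u 2 * (h (v + u) * v 2) + ‖u‖ ^ 2 * h (v + u)) γ := IR'.add i3
  have hR : ∫ v, (2 * u 0 * (h (v + u) * v 0) + 2 * u 1 * (h (v + u) * v 1) +
      2 * u 2 * (h (v + u) * v 2) + ‖u‖ ^ 2 * h (v + u)) ∂γ = 0 := by
    rw [integral_add IR' i3, integral_add i01 i2, integral_add i0 i1, integral_const_mul, integral_const_mul,
      integral_const_mul, integral_const_mul, G2 0, G2 1, G2 2, H1]
    ring
  have G3 : ∫ v, h (v + u) * ‖v‖ ^ 2 ∂γ = 0 := by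
    rw [eR, integral_add hIg2 IR, hR, add_zero] at H3
    exact H3
  refine ⟨G1, fun i => ?_, ?_⟩
  · rw [← integral_gaussMeasure_eq_integral_mul hθ (fun v => h (v + u) * v i)]; exact G2 i
  · rw [← integral_gaussMeasure_eq_integral_mul hθ (fun v => h (v + u) * ‖v‖ ^ 2)]; exact G3

end Maxwellian

/-! ### § 2 Kinematics of the one-body empirical field under the boost -/

section Field

variable {n : ℕ}

/-- **Boost covariance of the one-body empirical field**:
`A_{χ,h}(boostAt u t y) = A_{χ(· + proj (t u)), h(· + u)}(y)`. [folklore] -/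
theorem oneBodyField_boostAt (χ : T3 → ℝ) (h : V3 → ℝ) (u : V3) (t : ℝ) (y : Config n (Fin 3) T3) :
    ∫ y', χ y'.1 * h y'.2 ∂(empiricalMeasure (boostAt u t y)) =
      ∫ y', χ (y'.1 + Torus.proj (t • u)) * h (y'.2 + u) ∂(empiricalMeasure y) := by
  rw [oneBodyField_eq_sum χ h (boostAt u t y),
    oneBodyField_eq_sum (fun x => χ (x + Torus.proj (t • u))) (fun v => h (v + u)) y]
  rfl

/-- The velocity translation is the boost at time `0`: `velShift u = boostAt u 0`. [folklore] -/
theorem velShift_eq_boostAt_zero (u : V3) (y : Config n (Fin 3) T3) : velShift u y = boostAt u 0 y := by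
  rw [boostAt_zero_right]
  rfl

/-- **Linearity of the one-body empirical field in the test function.** [folklore] -/
theorem oneBodyField_sub (χ₁ χ₂ : T3 → ℝ) (h : V3 → ℝ) (y : Config n (Fin 3) T3) :
    ∫ y', (χ₁ y'.1 - χ₂ y'.1) * h y'.2 ∂(empiricalMeasure y) =
      (∫ y', χ₁ y'.1 * h y'.2 ∂(empiricalMeasure y)) - ∫ y', χ₂ y'.1 * h y'.2 ∂(empiricalMeasure y) := by
  rw [oneBodyField_eq_sum (fun x => χ₁ x - χ₂ x) h y, oneBodyField_eq_sum χ₁ h y, oneBodyField_eq_sum χ₂ h y,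
    ← mul_sub, ← Finset.sum_sub_distrib]
  congr 1
  refine Finset.sum_congr rfl fun i _ => ?_
  ring

end Field

/-! ### § 3 Statics and the two-time error under the centred canonical law -/

section Statics

/-- **Exact equal-time variance** (`torusStaticVariance` with `Φ_0 = id` a.e. removed):
`(N+1) · E_{G_0}[A_g(ψ)²] = (∫ ψ²) · ∫ g² M_θ` for continuous `ψ`, continuous polynomially bounded `g` with
`∫ g M_θ = 0`, `0 < σ < 1/2`, `0 < θ`, every flow. [folklore] -/
theorem succ_mul_integral_sq_oneBodyField {σ θ : ℝ} (hσ : 0 < σ) (hσ2 : σ < 1 / 2) (hθ : 0 < θ) {g : V3 → ℝ}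
    (hg : Continuous g) (hpoly : ∃ (C : ℝ) (k : ℕ), ∀ v, |g v| ≤ C * (1 + ‖v‖) ^ k)
    (hg1 : ∫ v, g v * localMaxwellian 1 θ (0 : V3) v = 0) (N : ℕ)
    (Ψ : HardSphereFlow (Torus.geometry (Fin 3)) (hsDiameter σ N) (N + 1)) {ψ : T3 → ℝ} (hψ : Continuous ψ) :
    ((N : ℝ) + 1) * ∫ z, (∫ y, ψ y.1 * g y.2 ∂(empiricalMeasure z)) ^ 2
        ∂(localGibbsLaw σ (fun _ => 1) (fun _ => 0) (fun _ => θ) N Ψ) =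
      (∫ x, ψ x * ψ x) * ∫ v, g v ^ 2 * localMaxwellian 1 θ (0 : V3) v := by
  rw [← torusStaticVariance σ hσ hσ2 θ hθ g hg hpoly hg1 N Ψ ψ hψ]
  congr 1
  refine integral_congr_ae ?_
  filter_upwards [ae_mem_good_localGibbsLaw σ (fun _ => 1) (fun _ => 0) (fun _ => θ) N Ψ] with z hz
  rw [Ψ.flow_zero z hz, sq]

/-- **The cost of a perturbed test function in the two-time correlation** under the centred canonical law
`G_0 = localGibbsLaw σ 1 0 θ N Ψ`: for continuous `χ₁, χ`, continuous polynomially bounded `g ⊥ 1` and every `t`,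
`(N+1) |E[A_g(χ₁)(Ψ_t w) A_g(χ)(w)] − E[A_g(χ)(Ψ_t w) A_g(χ)(w)]| ≤ (∫(χ₁−χ)² ∫g²M_θ)^{1/2} (∫χ² ∫g²M_θ)^{1/2}`
(linearity in the test function, Cauchy–Schwarz, stationarity, exact statics). [folklore] -/
theorem succ_mul_abs_corr_sub_le {σ θ : ℝ} (hσ : 0 < σ) (hσ2 : σ < 1 / 2) (hθ : 0 < θ) {g : V3 → ℝ}
    (hg : Continuous g) {C : ℝ} {k : ℕ} (hCk : ∀ v, |g v| ≤ C * (1 + ‖v‖) ^ k)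
    (hg1 : ∫ v, g v * localMaxwellian 1 θ (0 : V3) v = 0) (N : ℕ)
    (Ψ : HardSphereFlow (Torus.geometry (Fin 3)) (hsDiameter σ N) (N + 1)) {χ₁ χ : T3 → ℝ}
    (hχ₁ : Continuous χ₁) (hχ : Continuous χ) (t : ℝ) :
    ((N : ℝ) + 1) * |(∫ w, (∫ y, χ₁ y.1 * g y.2 ∂(empiricalMeasure (Ψ.flow t w))) *
          (∫ y, χ y.1 * g y.2 ∂(empiricalMeasure w))
          ∂(localGibbsLaw σ (fun _ => 1) (fun _ => 0) (fun _ => θ) N Ψ)) -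
        ∫ w, (∫ y, χ y.1 * g y.2 ∂(empiricalMeasure (Ψ.flow t w))) *
          (∫ y, χ y.1 * g y.2 ∂(empiricalMeasure w))
          ∂(localGibbsLaw σ (fun _ => 1) (fun _ => 0) (fun _ => θ) N Ψ)| ≤
      Real.sqrt ((∫ x, (χ₁ x - χ x) * (χ₁ x - χ x)) * ∫ v, g v ^ 2 * localMaxwellian 1 θ (0 : V3) v) *
        Real.sqrt ((∫ x, χ x * χ x) * ∫ v, g v ^ 2 * localMaxwellian 1 θ (0 : V3) v) := by
  have hN : (0 : ℝ) < (N : ℝ) + 1 := by positivity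
  have hpoly : ∃ (C : ℝ) (k : ℕ), ∀ v, |g v| ≤ C * (1 + ‖v‖) ^ k := ⟨C, k, hCk⟩
  have hd : Continuous fun x => χ₁ x - χ x := hχ₁.sub hχ
  have key := abs_integral_comp_mul_sub_le (measurePreserving_flow_localGibbsLaw (σ := σ) 1 θ (0 : V3) Ψ t)
    (memLp_two_oneBodyField_localGibbsLaw_one hθ hσ2.le N Ψ hχ₁ hg hCk)
    (memLp_two_oneBodyField_localGibbsLaw_one hθ hσ2.le N Ψ hχ hg hCk)
    (measurable_oneBodyField hd hg)
    (memLp_two_oneBodyField_localGibbsLaw_one hθ hσ2.le N Ψ hd hg hCk)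
    (fun w => (oneBodyField_sub χ₁ χ g w).symm)
  refine (mul_le_mul_of_nonneg_left key hN.le).trans_eq ?_
  rw [← succ_mul_integral_sq_oneBodyField hσ hσ2 hθ hg hpoly hg1 N Ψ hd,
    ← succ_mul_integral_sq_oneBodyField hσ hσ2 hθ hg hpoly hg1 N Ψ hχ, Real.sqrt_mul hN.le,
    Real.sqrt_mul hN.le, mul_mul_mul_comm, Real.mul_self_sqrt hN.le]

end Statics

/-! ### The registered bookkeeping stub -/

section Registered

/-- **Registered bookkeeping stub `stub_maxwellianOrthGalilean` of crux stmt-AtomisticToContinuum-17740 (prep lemma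
of the Galilean rung): Maxwellian orthogonality is Galilean covariant.** For `θ > 0`, `u ∈ ℝ³` and a continuous
`h` of polynomial growth, `M_{θ,u}`-orthogonality of `h` to `1, vᵢ, |v|²` — the hypotheses of the drifted form of
`OneBodyCompleteness` — implies `M_{θ,0}`-orthogonality of the translated profile `h(· + u)` to `1, vᵢ, |v|²` — the
hypotheses of `OneBodyCompleteness` itself (`orth_translate`). [folklore] -/
theorem stub_maxwellianOrthGalilean : ∀ θ : ℝ, 0 < θ → ∀ u : Literature.MathematicalPhysics.KineticTheory.V3, ∀ h : Literature.MathematicalPhysics.KineticTheory.V3 → ℝ, Continuous h → (∃ (C : ℝ) (k : ℕ), ∀ v, |h v| ≤ C * (1 + ‖v‖) ^ k) → (∫ v, h v * Literature.Analysis.FluidPDE.localMaxwellian 1 θ u v = 0) → (∀ i : Fin 3, ∫ v, h v * v i * Literature.Analysis.FluidPDE.localMaxwellian 1 θ u v = 0) → (∫ v, h v * ‖v‖ ^ 2 * Literature.Analysis.FluidPDE.localMaxwellian 1 θ u v = 0) → (∫ v, h (v + u) * Literature.Analysis.FluidPDE.localMaxwellian 1 θ (0 : Literature.MathematicalPhysics.KineticTheory.V3)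 v = 0) ∧ (∀ i : Fin 3, ∫ v, h (v + u) * v i * Literature.Analysis.FluidPDE.localMaxwellian 1 θ (0 : Literature.MathematicalPhysics.KineticTheory.V3) v = 0) ∧ (∫ v, h (v + u) * ‖v‖ ^ 2 * Literature.Analysis.FluidPDE.localMaxwellian 1 θ (0 : Literature.MathematicalPhysics.KineticTheory.V3) v = 0) :=
  fun _ hθ u _ hh hpoly h1 h2 h3 => by
    obtain ⟨C, k, hCk⟩ := hpoly
    exact orth_translate hθ u hh hCk h1 h2 h3

end Registered

end Summit.AtomisticToContinuum.HydrodynamicLimit.Theorems.LTEInBand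

end
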